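import Literature.NumberTheory.Automorphic.TwistedQuotientIntegralFunctions
import Literature.NumberTheory.Automorphic.CuspidalCohomologyGLShapiroSum
import Literature.Algebra.Homology.GroupCohomologyRetract
import Mathlib.RepresentationTheory.Homological.GroupCohomology.Shapiro
import HarnessLib

/-!
# Shapiro's lemma for the induced-type module `indFun`: `H^q(Γ, indFun σ) ≅ ⊕_x H^q(Γ_x, N_x)`

Topic `NumberTheory/Automorphic`; namespace `Literature.NumberTheory.Automorphic.TwistedQuotient`.
Definitions with bodies and theorems; no named fact, no instance, no `sorry`.

The twisted-quotient files decompose the TWISTED model `Fun(𝒢 ⧸ L, V)_ρ` over the `Γ`-orbits on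
`𝒢 ⧸ L` (`CuspidalCohomologyGLShapiro`, `…ShapiroSum`). Here the same is done for the UNTWISTED,
induced-type model `indFun ι L σ = {F : 𝒢 → N | F(g l) = σ(l)⁻¹ F(g)}` (left translation by `Γ`
through `ι`; `TwistedQuotientIntegralFunctions`), which — unlike the twisted model — makes sense for
a representation `σ` of the LEVEL `L` only (an `𝒪`-lattice `M ⊂ V` stable under the level but not
under `G(ℚ)`: the integral structure `M̃` of [Scholze2015, §V.4], there `intFunIso : M̃ ≅ indFun`).

For `g₀ ∈ 𝒢` with coset `x₀ = g₀ L`, stabiliser `Γ_{x₀} = {γ | g₀⁻¹ ι(γ) g₀ ∈ L}`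
(`orbitStabilizer`, `mem_orbitStabilizer_coe_iff`) acting on `N` through
`conjHom : Γ_{x₀} → L, γ ↦ g₀⁻¹ ι(γ) g₀` (`indStabRep`):

* `indOrbitRestrict : indFun σ ⟶ Coind_{Γ_{x₀}}^Γ N`, `F ↦ (γ ↦ F(ι(γ)⁻¹ g₀))`, and
  `indOrbitExtend : Coind ⟶ indFun σ` (extension by zero from the orbit);
  `indOrbitExtend ≫ indOrbitRestrict = 𝟙`, `extend_x ≫ restrict_y = 0` for different orbits,
  `∑_{x ∈ s} restrict_x ≫ extend_x = 𝟙` for a complete system of orbit representatives;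
* in cohomology (Mathlib's Shapiro isomorphism `groupCohomology.coindIso`):
  `indToOrbitCohomology`, `indOfOrbitCohomology`, and
  **`indToOrbitCohomology_pi_bijective : H^q(Γ, indFun σ) ≅ ⊕_{x ∈ s} H^q(Γ_x, N_x)`**, with the
  corollary `moduleFinite_cohomology_indFun_of_orbits` (finitely many orbits with finitely
  generated stabiliser cohomology ⇒ `H^q(Γ, indFun σ)` finitely generated) — the finiteness of
  `H^q(X_U, M̃)` over `𝒪` used in the proof of [Scholze2015, Thm. V.4.1].

## References

* P. Scholze, *On torsion in the cohomology of locally symmetric varieties*, Ann. of Math. 182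
  (2015), §V.4, proof of Thm. V.4.1. [Scholze2015]
* K. S. Brown, *Cohomology of Groups*, GTM 87, III §5–6 (Shapiro's lemma). [Brown1982CohomologyGroups]
* J. Getz, H. Hahn, *An introduction to automorphic representations*, GTM 300, §15.2. [GetzHahn2024]
-/

noncomputable section

open CategoryTheory
open scoped Classical

universe u

namespace Literature.NumberTheory.Automorphic

namespace TwistedQuotient

variable {A : Type u} [CommRing A] {Γ 𝒢 : Type u} [Group Γ] [Group 𝒢] (ι : Γ →* 𝒢)
  (L : Subgroup 𝒢) {N : Type u} [AddCommGroup N] [Module A N] (σ : Representation A L N)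
  (g₀ : 𝒢)

/-! ### The stabiliser representation attached to a coset representative -/

/-- `γ ↦ g₀⁻¹ ι(γ) g₀`, the homomorphism `Γ_{g₀L} → L`. [folklore] -/
def conjHom : orbitStabilizer ι L (g₀ : 𝒢 ⧸ L) →* L where
  toFun γ := ⟨g₀⁻¹ * ι γ * g₀, (mem_orbitStabilizer_coe_iff ι L g₀).1 γ.2⟩
  map_one' := Subtype.ext (by simp)
  map_mul' γ γ' := Subtype.ext (by
    change g₀⁻¹ * ι ((γ : Γ) * γ') * g₀ = g₀⁻¹ * ι γ * g₀ * (g₀⁻¹ * ι γ' * g₀)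
    rw [map_mul]; group)

/-- Unfolding lemma for `conjHom`. [folklore] -/
@[simp]
theorem coe_conjHom_apply (γ : orbitStabilizer ι L (g₀ : 𝒢 ⧸ L)) :
    ((conjHom ι L g₀ γ : L) : 𝒢) = g₀⁻¹ * ι γ * g₀ :=
  rfl

/-- `N` as a representation of the stabiliser `Γ_{g₀L}` through `γ ↦ σ(g₀⁻¹ ι(γ) g₀)`. [folklore] -/
def indStabRep : Representation A (orbitStabilizer ι L (g₀ : 𝒢 ⧸ L)) N :=
  σ.comp (conjHom ι L g₀)

/-- Unfolding lemma for `indStabRep`. [folklore] -/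
theorem indStabRep_apply (γ : orbitStabilizer ι L (g₀ : 𝒢 ⧸ L)) :
    indStabRep ι L σ g₀ γ = σ (conjHom ι L g₀ γ) :=
  rfl

/-- The stabiliser representation as an object of `Rep`. [folklore] -/
abbrev indStabilizerRep : Rep A (orbitStabilizer ι L (g₀ : 𝒢 ⧸ L)) :=
  Rep.of (indStabRep ι L σ g₀)

/-! ### Restriction to an orbit -/

/-- A group identity: `(ι γ)⁻¹ g₀ · (g₀⁻¹ (ι s)⁻¹ g₀) = (ι (s γ))⁻¹ g₀`. [folklore] -/
private theorem inv_mul_rep_mul (s γ : Γ) :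
    (ι γ)⁻¹ * g₀ * (g₀⁻¹ * (ι s)⁻¹ * g₀) = (ι (s * γ))⁻¹ * g₀ := by
  rw [map_mul]; group

/-- **Restriction to the orbit of `g₀L`** (linear map): `F ↦ (γ ↦ F(ι(γ)⁻¹ g₀))`, valued in the
coinduced module `{f : Γ → N | f(s γ) = σ(g₀⁻¹ ι(s) g₀) f(γ)}`. [folklore] -/
def indOrbitRestrictLinear :
    indFun ι L σ →ₗ[A]
      Representation.coindV (orbitStabilizer ι L (g₀ : 𝒢 ⧸ L)).subtype (indStabRep ι L σ g₀) where
  toFun F := ⟨fun γ => F.1 ((ι γ)⁻¹ * g₀), fun s γ => by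
    have hmem : g₀⁻¹ * (ι (s : Γ))⁻¹ * g₀ ∈ L := by
      have h := inv_mem ((mem_orbitStabilizer_coe_iff ι L g₀).1 s.2)
      simpa only [mul_inv_rev, inv_inv, mul_assoc] using h
    have hF := F.2 ((ι γ)⁻¹ * g₀) ⟨_, hmem⟩
    change F.1 ((ι ((s : Γ) * γ))⁻¹ * g₀) = σ (conjHom ι L g₀ s) (F.1 ((ι γ)⁻¹ * g₀))
    rw [← inv_mul_rep_mul ι g₀ s γ]
    refine hF.trans ?_
    congr 2
    rw [← inv_inj, inv_inv]
    exact Subtype.ext (by simp [mul_assoc])⟩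
  map_add' F F' := Subtype.ext (funext fun γ => rfl)
  map_smul' a F := Subtype.ext (funext fun γ => rfl)

/-- Unfolding lemma for `indOrbitRestrictLinear`. [folklore] -/
@[simp]
theorem indOrbitRestrictLinear_apply_coe (F : indFun ι L σ) (γ : Γ) :
    (indOrbitRestrictLinear ι L σ g₀ F : Γ → N) γ = F.1 ((ι γ)⁻¹ * g₀) :=
  rfl

/-- The left-translation action on `indFun`: `(γ' • F)(g) = F(ι(γ')⁻¹ g)`. [folklore] -/
theorem indFun_ρ_apply_val (γ' : Γ) (F : indFun ι L σ) (g : 𝒢) :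
    ((indFun ι L σ).ρ γ' F).1 g = F.1 ((ι γ')⁻¹ * g) :=
  rfl

/-- Restriction to an orbit is `Γ`-equivariant. [folklore] -/
theorem indOrbitRestrictLinear_equivariant (γ' : Γ) (F : indFun ι L σ) :
    indOrbitRestrictLinear ι L σ g₀ ((indFun ι L σ).ρ γ' F) =
      Representation.coind (orbitStabilizer ι L (g₀ : 𝒢 ⧸ L)).subtype (indStabRep ι L σ g₀) γ'
        (indOrbitRestrictLinear ι L σ g₀ F) := by
  refine Subtype.ext (funext fun γ => ?_)
  rw [coind_apply_coe, indOrbitRestrictLinear_apply_coe, indOrbitRestrictLinear_apply_coe,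
    indFun_ρ_apply_val, map_mul, mul_inv_rev, mul_assoc]

/-- **Restriction to the orbit of `g₀L`** as a morphism `indFun σ ⟶ Coind_{Γ_{g₀L}}^Γ N`.
[cite: Brown1982CohomologyGroups, III §5–6] -/
def indOrbitRestrict :
    indFun ι L σ ⟶
      Rep.coind (orbitStabilizer ι L (g₀ : 𝒢 ⧸ L)).subtype (indStabilizerRep ι L σ g₀) :=
  Rep.ofHom (LinearMap.intertwiningMap_of_isIntertwiningMap (indFun ι L σ).ρ
    (Representation.coind (orbitStabilizer ι L (g₀ : 𝒢 ⧸ L)).subtype (indStabRep ι L σ g₀))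
    (indOrbitRestrictLinear ι L σ g₀) (indOrbitRestrictLinear_equivariant ι L σ g₀))

/-- Unfolding lemma for `indOrbitRestrict`. [folklore] -/
@[simp]
theorem indOrbitRestrict_hom_apply_coe (F : indFun ι L σ) (γ : Γ) :
    (((indOrbitRestrict ι L σ g₀).hom F :
        Representation.coindV (orbitStabilizer ι L (g₀ : 𝒢 ⧸ L)).subtype
          (indStabRep ι L σ g₀)) : Γ → N) γ = F.1 ((ι γ)⁻¹ * g₀) :=
  rfl

/-! ### Extension by zero from an orbit -/

/-- For `ι(γ) g₀ L = g L`, the `L`-coordinate `g₀⁻¹ ι(γ)⁻¹ g ∈ L`. [folklore] -/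
theorem rep_coord_mem {γ : Γ} {g : 𝒢} (h : ι γ • (g₀ : 𝒢 ⧸ L) = (g : 𝒢 ⧸ L)) :
    g₀⁻¹ * (ι γ)⁻¹ * g ∈ L := by
  rw [MulAction.Quotient.smul_coe, smul_eq_mul, QuotientGroup.eq] at h
  simpa only [mul_inv_rev] using h

/-- **Extension by zero from the orbit of `g₀L`** (bare function): at `g = ι(γ) g₀ l` the value is
`σ(l)⁻¹ f(γ⁻¹)` (independent of the choice, `indOrbitExtendFun_eq`), and `0` off the orbit.
[folklore] -/
def indOrbitExtendFun (f : Γ → N) (g : 𝒢) : N :=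
  if h : ∃ γ : Γ, ι γ • (g₀ : 𝒢 ⧸ L) = (g : 𝒢 ⧸ L) then
    σ (⟨g₀⁻¹ * (ι (Classical.choose h))⁻¹ * g, rep_coord_mem ι L g₀ (Classical.choose_spec h)⟩ : L)⁻¹
      (f (Classical.choose h)⁻¹)
  else 0

/-- Off the orbit the extension vanishes. [folklore] -/
theorem indOrbitExtendFun_of_not (f : Γ → N) {g : 𝒢}
    (h : ¬ ∃ γ : Γ, ι γ • (g₀ : 𝒢 ⧸ L) = (g : 𝒢 ⧸ L)) :
    indOrbitExtendFun ι L σ g₀ f g = 0 := by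
  rw [indOrbitExtendFun, dif_neg h]

/-- Independence of the representative: for `γ, γ'` both moving `g₀L` to `gL`,
`σ(l_{γ'})⁻¹ f(γ'⁻¹) = σ(l_γ)⁻¹ f(γ⁻¹)`. [folklore] -/
theorem indOrbitExtend_indep
    (f : Representation.coindV (orbitStabilizer ι L (g₀ : 𝒢 ⧸ L)).subtype (indStabRep ι L σ g₀))
    {g : 𝒢} {γ γ' : Γ} (hγ : ι γ • (g₀ : 𝒢 ⧸ L) = (g : 𝒢 ⧸ L))
    (hγ' : ι γ' • (g₀ : 𝒢 ⧸ L) = (g : 𝒢 ⧸ L)) :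
    σ (⟨g₀⁻¹ * (ι γ')⁻¹ * g, rep_coord_mem ι L g₀ hγ'⟩ : L)⁻¹ ((f : Γ → N) γ'⁻¹) =
      σ (⟨g₀⁻¹ * (ι γ)⁻¹ * g, rep_coord_mem ι L g₀ hγ⟩ : L)⁻¹ ((f : Γ → N) γ⁻¹) := by
  -- `s = γ'⁻¹ γ ∈ Γ_{g₀L}` and `γ'⁻¹ = s γ⁻¹`
  have hs : γ'⁻¹ * γ ∈ orbitStabilizer ι L (g₀ : 𝒢 ⧸ L) :=
    inv_mul_mem_orbitStabilizer ι L (g₀ : 𝒢 ⧸ L) (hγ.trans hγ'.symm)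
  have hf := f.2 ⟨γ'⁻¹ * γ, hs⟩ γ⁻¹
  change (f : Γ → N) (γ'⁻¹ * γ * γ⁻¹) = σ (conjHom ι L g₀ ⟨γ'⁻¹ * γ, hs⟩) ((f : Γ → N) γ⁻¹) at hf
  rw [mul_inv_cancel_right] at hf
  rw [hf, ← Module.End.mul_apply, ← map_mul]
  refine congrArg (fun m : L => σ m ((f : Γ → N) γ⁻¹)) (Subtype.ext ?_)
  simp only [Subgroup.coe_mul, InvMemClass.coe_inv, coe_conjHom_apply, map_mul, map_inv]
  group

/-- **The extension is well defined**: `E f g = σ(l_γ)⁻¹ f(γ⁻¹)` for EVERY `γ` with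
`ι(γ) g₀ L = g L`, `l_γ = g₀⁻¹ ι(γ)⁻¹ g`. [folklore] -/
theorem indOrbitExtendFun_eq
    (f : Representation.coindV (orbitStabilizer ι L (g₀ : 𝒢 ⧸ L)).subtype (indStabRep ι L σ g₀))
    {g : 𝒢} {γ : Γ} (hγ : ι γ • (g₀ : 𝒢 ⧸ L) = (g : 𝒢 ⧸ L)) :
    indOrbitExtendFun ι L σ g₀ f g =
      σ (⟨g₀⁻¹ * (ι γ)⁻¹ * g, rep_coord_mem ι L g₀ hγ⟩ : L)⁻¹ ((f : Γ → N) γ⁻¹) := by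
  have h : ∃ γ : Γ, ι γ • (g₀ : 𝒢 ⧸ L) = (g : 𝒢 ⧸ L) := ⟨γ, hγ⟩
  rw [indOrbitExtendFun, dif_pos h]
  exact indOrbitExtend_indep ι L σ g₀ f hγ (Classical.choose_spec h)

/-- Extension by zero, as an `A`-linear map `Coind → (𝒢 → N)`. [folklore] -/
def indOrbitExtendLinear :
    Representation.coindV (orbitStabilizer ι L (g₀ : 𝒢 ⧸ L)).subtype (indStabRep ι L σ g₀) →ₗ[A]
      (𝒢 → N) where
  toFun f := indOrbitExtendFun ι L σ g₀ f
  map_add' f f' := by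
    funext g
    by_cases h : ∃ γ : Γ, ι γ • (g₀ : 𝒢 ⧸ L) = (g : 𝒢 ⧸ L)
    · obtain ⟨γ, hγ⟩ := h
      rw [Pi.add_apply, indOrbitExtendFun_eq ι L σ g₀ _ hγ, indOrbitExtendFun_eq ι L σ g₀ _ hγ,
        indOrbitExtendFun_eq ι L σ g₀ _ hγ]
      change σ _ ((f : Γ → N) γ⁻¹ + (f' : Γ → N) γ⁻¹) = _
      rw [map_add]
    · rw [Pi.add_apply, indOrbitExtendFun_of_not ι L σ g₀ _ h, indOrbitExtendFun_of_not ι L σ g₀ _ h,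
        indOrbitExtendFun_of_not ι L σ g₀ _ h, add_zero]
  map_smul' a f := by
    funext g
    by_cases h : ∃ γ : Γ, ι γ • (g₀ : 𝒢 ⧸ L) = (g : 𝒢 ⧸ L)
    · obtain ⟨γ, hγ⟩ := h
      rw [Pi.smul_apply, indOrbitExtendFun_eq ι L σ g₀ _ hγ, indOrbitExtendFun_eq ι L σ g₀ _ hγ,
        RingHom.id_apply]
      change σ _ (a • (f : Γ → N) γ⁻¹) = _
      rw [map_smul]
    · rw [Pi.smul_apply, indOrbitExtendFun_of_not ι L σ g₀ _ h, indOrbitExtendFun_of_not ι L σ g₀ _ h,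
        smul_zero]

/-- Unfolding lemma for `indOrbitExtendLinear`. [folklore] -/
@[simp]
theorem indOrbitExtendLinear_apply
    (f : Representation.coindV (orbitStabilizer ι L (g₀ : 𝒢 ⧸ L)).subtype (indStabRep ι L σ g₀)) :
    indOrbitExtendLinear ι L σ g₀ f = indOrbitExtendFun ι L σ g₀ f :=
  rfl

/-- The extension has the induced-type equivariance `E f (g l) = σ(l)⁻¹ E f g`. [folklore] -/
theorem indOrbitExtendFun_mem
    (f : Representation.coindV (orbitStabilizer ι L (g₀ : 𝒢 ⧸ L)).subtype (indStabRep ι L σ g₀)) :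
    indOrbitExtendFun ι L σ g₀ f ∈ indFunSubmodule L σ := by
  intro g l
  by_cases h : ∃ γ : Γ, ι γ • (g₀ : 𝒢 ⧸ L) = (g : 𝒢 ⧸ L)
  · obtain ⟨γ, hγ⟩ := h
    have hγ' : ι γ • (g₀ : 𝒢 ⧸ L) = ((g * l : 𝒢) : 𝒢 ⧸ L) := by
      rw [hγ, QuotientGroup.mk_mul_of_mem g l.2]
    rw [indOrbitExtendFun_eq ι L σ g₀ f hγ', indOrbitExtendFun_eq ι L σ g₀ f hγ,
      ← Module.End.mul_apply, ← map_mul]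
    refine congrArg (fun m : L => σ m ((f : Γ → N) γ⁻¹)) ?_
    have hl : (⟨g₀⁻¹ * (ι γ)⁻¹ * (g * l), rep_coord_mem ι L g₀ hγ'⟩ : L) =
        ⟨g₀⁻¹ * (ι γ)⁻¹ * g, rep_coord_mem ι L g₀ hγ⟩ * l :=
      Subtype.ext (by simp only [Subgroup.coe_mul, mul_assoc])
    rw [hl, mul_inv_rev]
  · have h' : ¬ ∃ γ : Γ, ι γ • (g₀ : 𝒢 ⧸ L) = ((g * l : 𝒢) : 𝒢 ⧸ L) := by
      rwa [QuotientGroup.mk_mul_of_mem g l.2]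
    rw [indOrbitExtendFun_of_not ι L σ g₀ f h', indOrbitExtendFun_of_not ι L σ g₀ f h, map_zero]

/-- Extension by zero is `Γ`-equivariant (the orbit is `Γ`-stable). [folklore] -/
theorem indOrbitExtendFun_coind (γ' : Γ)
    (f : Representation.coindV (orbitStabilizer ι L (g₀ : 𝒢 ⧸ L)).subtype (indStabRep ι L σ g₀))
    (g : 𝒢) :
    indOrbitExtendFun ι L σ g₀
        (Representation.coind (orbitStabilizer ι L (g₀ : 𝒢 ⧸ L)).subtype (indStabRep ι L σ g₀) γ' f)
        g =
      indOrbitExtendFun ι L σ g₀ f ((ι γ')⁻¹ * g) := by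
  by_cases h : ∃ γ : Γ, ι γ • (g₀ : 𝒢 ⧸ L) = (g : 𝒢 ⧸ L)
  · obtain ⟨γ, hγ⟩ := h
    have h1 : ι (γ'⁻¹ * γ) • (g₀ : 𝒢 ⧸ L) = (((ι γ')⁻¹ * g : 𝒢) : 𝒢 ⧸ L) := by
      rw [map_mul, map_inv ι, mul_smul, hγ, MulAction.Quotient.smul_coe, smul_eq_mul]
    rw [indOrbitExtendFun_eq ι L σ g₀ _ hγ, indOrbitExtendFun_eq ι L σ g₀ _ h1, coind_apply_coe,
      mul_inv_rev, inv_inv]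
    refine congrArg (fun m : L => σ m⁻¹ ((f : Γ → N) (γ⁻¹ * γ'))) (Subtype.ext ?_)
    simp only [map_mul, map_inv]
    group
  · have h' : ¬ ∃ γ : Γ, ι γ • (g₀ : 𝒢 ⧸ L) = (((ι γ')⁻¹ * g : 𝒢) : 𝒢 ⧸ L) := by
      rintro ⟨γ, hγ⟩
      refine h ⟨γ' * γ, ?_⟩
      rw [map_mul, mul_smul, hγ, MulAction.Quotient.smul_coe, smul_eq_mul, mul_inv_cancel_left]
    rw [indOrbitExtendFun_of_not ι L σ g₀ _ h, indOrbitExtendFun_of_not ι L σ g₀ _ h']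

/-- **Extension by zero from the orbit of `g₀L`** as a morphism `Coind_{Γ_{g₀L}}^Γ N ⟶ indFun σ`.
[cite: Brown1982CohomologyGroups, III §5–6] -/
def indOrbitExtend :
    Rep.coind (orbitStabilizer ι L (g₀ : 𝒢 ⧸ L)).subtype (indStabilizerRep ι L σ g₀) ⟶
      indFun ι L σ :=
  Rep.ofHom
    ⟨{ toFun := fun f => ⟨indOrbitExtendFun ι L σ g₀ f, indOrbitExtendFun_mem ι L σ g₀ f⟩
       map_add' := fun f f' => Subtype.ext ((indOrbitExtendLinear ι L σ g₀).map_add f f')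
       map_smul' := fun a f => Subtype.ext ((indOrbitExtendLinear ι L σ g₀).map_smul a f) },
      fun γ' => LinearMap.ext fun f => Subtype.ext (funext fun g =>
        indOrbitExtendFun_coind ι L σ g₀ γ' f g)⟩

/-- Unfolding lemma for `indOrbitExtend`. [folklore] -/
@[simp]
theorem indOrbitExtend_hom_apply_val
    (f : Representation.coindV (orbitStabilizer ι L (g₀ : 𝒢 ⧸ L)).subtype (indStabRep ι L σ g₀))
    (g : 𝒢) :
    ((indOrbitExtend ι L σ g₀).hom f).1 g = indOrbitExtendFun ι L σ g₀ f g :=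
  rfl

/-! ### The identities `E ≫ R = 𝟙`, `E_x ≫ R_y = 0`, `∑ R_x ≫ E_x = 𝟙` -/

/-- **Restriction after extension is the identity** on `Coind_{Γ_{g₀L}}^Γ N`.
[cite: Brown1982CohomologyGroups, III §5–6] -/
theorem indOrbitExtend_comp_indOrbitRestrict :
    indOrbitExtend ι L σ g₀ ≫ indOrbitRestrict ι L σ g₀ = 𝟙 _ := by
  refine Rep.hom_ext (Representation.IntertwiningMap.ext (LinearMap.ext fun f => ?_))
  refine Subtype.ext (funext fun γ => ?_)
  change indOrbitExtendFun ι L σ g₀ f ((ι γ)⁻¹ * g₀) = (f : Γ → N) γ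
  have h1 : ι γ⁻¹ • (g₀ : 𝒢 ⧸ L) = (((ι γ)⁻¹ * g₀ : 𝒢) : 𝒢 ⧸ L) := by
    rw [map_inv ι, MulAction.Quotient.smul_coe, smul_eq_mul]
  rw [indOrbitExtendFun_eq ι L σ g₀ f h1, inv_inv]
  have hl : (⟨g₀⁻¹ * (ι γ⁻¹)⁻¹ * ((ι γ)⁻¹ * g₀), rep_coord_mem ι L g₀ h1⟩ : L) = 1 :=
    Subtype.ext (by simp)
  rw [hl, inv_one, map_one, Module.End.one_apply]

/-- For representatives `g₀, g₁` of DIFFERENT `Γ`-orbits, extension from the orbit of `g₀L`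
followed by restriction to the orbit of `g₁L` vanishes. [folklore] -/
theorem indOrbitExtend_comp_indOrbitRestrict_of_not {g₁ : 𝒢}
    (h : ¬ ∃ γ : Γ, ι γ • (g₀ : 𝒢 ⧸ L) = (g₁ : 𝒢 ⧸ L)) :
    indOrbitExtend ι L σ g₀ ≫ indOrbitRestrict ι L σ g₁ = 0 := by
  refine Rep.hom_ext (Representation.IntertwiningMap.ext (LinearMap.ext fun f => ?_))
  refine Subtype.ext (funext fun γ => ?_)
  change indOrbitExtendFun ι L σ g₀ f ((ι γ)⁻¹ * g₁) = 0
  have h' : ¬ ∃ γ' : Γ, ι γ' • (g₀ : 𝒢 ⧸ L) = (((ι γ)⁻¹ * g₁ : 𝒢) : 𝒢 ⧸ L) := fun ⟨γ', hγ'⟩ =>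
    h ⟨γ * γ', by
      rw [map_mul, mul_smul, hγ', MulAction.Quotient.smul_coe, smul_eq_mul, mul_inv_cancel_left]⟩
  rw [indOrbitExtendFun_of_not ι L σ g₀ _ h']

/-- `restrict ≫ extend` is multiplication by the indicator of the orbit. [folklore] -/
theorem indOrbitRestrict_comp_indOrbitExtend_hom_apply_val (F : indFun ι L σ) (g : 𝒢) :
    ((indOrbitRestrict ι L σ g₀ ≫ indOrbitExtend ι L σ g₀).hom F).1 g =
      if ∃ γ : Γ, ι γ • (g₀ : 𝒢 ⧸ L) = (g : 𝒢 ⧸ L) then F.1 g else 0 := by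
  change indOrbitExtendFun ι L σ g₀ (indOrbitRestrictLinear ι L σ g₀ F) g = _
  split_ifs with h
  · obtain ⟨γ, hγ⟩ := h
    rw [indOrbitExtendFun_eq ι L σ g₀ _ hγ, indOrbitRestrictLinear_apply_coe, map_inv ι, inv_inv]
    have hF := F.2 (ι γ * g₀) ⟨g₀⁻¹ * (ι γ)⁻¹ * g, rep_coord_mem ι L g₀ hγ⟩
    have hg : ι γ * g₀ * (g₀⁻¹ * (ι γ)⁻¹ * g) = g := by group
    rw [hg] at hF
    exact hF.symm
  · exact indOrbitExtendFun_of_not ι L σ g₀ _ h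

/-- **Partition of unity over a complete system of orbit representatives**: if `s ⊂ 𝒢` is finite
and the cosets `gL`, `g ∈ s`, meet every `Γ`-orbit of `𝒢 ⧸ L` exactly once, then
`∑_{g ∈ s} restrict_g ≫ extend_g = 𝟙` on `indFun σ`. [cite: Brown1982CohomologyGroups, III §5–6] -/
theorem sum_indOrbitRestrict_comp_indOrbitExtend (s : Finset 𝒢)
    (hdisj : ∀ x ∈ s, ∀ y ∈ s, (∃ γ : Γ, ι γ • (x : 𝒢 ⧸ L) = (y : 𝒢 ⧸ L)) → x = y)
    (hcov : ∀ g : 𝒢, ∃ x ∈ s, ∃ γ : Γ, ι γ • (x : 𝒢 ⧸ L) = (g : 𝒢 ⧸ L)) :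
    ∑ x ∈ s, (indOrbitRestrict ι L σ x ≫ indOrbitExtend ι L σ x) = 𝟙 _ := by
  refine Rep.hom_ext (Representation.IntertwiningMap.ext (LinearMap.ext fun F => ?_))
  refine Subtype.ext (funext fun g => ?_)
  rw [Rep.sum_hom]
  change ((∑ x ∈ s, (indOrbitRestrict ι L σ x ≫ indOrbitExtend ι L σ x).hom) F).1 g = F.1 g
  rw [Representation.IntertwiningMap.sum_apply]
  have hval : ∀ (t : Finset 𝒢) (G : 𝒢 → indFun ι L σ), (∑ x ∈ t, G x).1 g = ∑ x ∈ t, (G x).1 g := by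
    intro t G
    induction t using Finset.induction_on with
    | empty => simp
    | insert a t ha ih => rw [Finset.sum_insert ha, Finset.sum_insert ha, ← ih]; rfl
  rw [hval, Finset.sum_congr rfl fun x _ =>
    indOrbitRestrict_comp_indOrbitExtend_hom_apply_val ι L σ x F g]
  obtain ⟨x₀, hx₀, γ₀, hγ₀⟩ := hcov g
  rw [Finset.sum_eq_single_of_mem x₀ hx₀ fun y hy hne => if_neg ?_, if_pos ⟨γ₀, hγ₀⟩]
  rintro ⟨γ, hγ⟩
  exact hne (hdisj y hy x₀ hx₀
    ⟨γ₀⁻¹ * γ, by rw [map_mul, mul_smul, hγ, ← hγ₀, map_inv ι, inv_smul_smul]⟩)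

/-! ### Shapiro: the decomposition in cohomology -/

/-- Restriction to the orbit of `g₀L` followed by Shapiro's isomorphism:
`H^q(Γ, indFun σ) → H^q(Γ, Coind) ≅ H^q(Γ_{g₀L}, N)`. [cite: Brown1982CohomologyGroups, III §6 (6.2)] -/
def indToOrbitCohomology (q : ℕ) :
    groupCohomology (indFun ι L σ) q ⟶ groupCohomology (indStabilizerRep ι L σ g₀) q :=
  groupCohomology.map (MonoidHom.id Γ) (indOrbitRestrict ι L σ g₀) q ≫
    (groupCohomology.coindIso (indStabilizerRep ι L σ g₀) q).hom

/-- Shapiro's isomorphism followed by extension by zero: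
`H^q(Γ_{g₀L}, N) ≅ H^q(Γ, Coind) → H^q(Γ, indFun σ)`. [cite: Brown1982CohomologyGroups, III §6 (6.2)] -/
def indOfOrbitCohomology (q : ℕ) :
    groupCohomology (indStabilizerRep ι L σ g₀) q ⟶ groupCohomology (indFun ι L σ) q :=
  (groupCohomology.coindIso (indStabilizerRep ι L σ g₀) q).inv ≫
    groupCohomology.map (MonoidHom.id Γ) (indOrbitExtend ι L σ g₀) q

/-- `of ≫ to = 𝟙` on `H^q(Γ_{g₀L}, N)`. [cite: Brown1982CohomologyGroups, III §6 (6.2)] -/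
@[reassoc]
theorem indOfOrbitCohomology_comp_indToOrbitCohomology (q : ℕ) :
    indOfOrbitCohomology ι L σ g₀ q ≫ indToOrbitCohomology ι L σ g₀ q = 𝟙 _ := by
  simp only [indOfOrbitCohomology, indToOrbitCohomology, Category.assoc]
  rw [← groupCohomology.map_id_comp_assoc, indOrbitExtend_comp_indOrbitRestrict,
    groupCohomology.map_id, Category.id_comp, Iso.inv_hom_id]

/-- `to ≫ of = H^q(restrict ≫ extend)`. [folklore] -/
theorem indToOrbitCohomology_comp_indOfOrbitCohomology_eq_map (q : ℕ) :
    indToOrbitCohomology ι L σ g₀ q ≫ indOfOrbitCohomology ι L σ g₀ q =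
      groupCohomology.map (MonoidHom.id Γ)
        (indOrbitRestrict ι L σ g₀ ≫ indOrbitExtend ι L σ g₀) q := by
  simp only [indOfOrbitCohomology, indToOrbitCohomology, Category.assoc, Iso.hom_inv_id_assoc]
  rw [← groupCohomology.map_id_comp]

/-- **`∑_x (to_x ≫ of_x) = 𝟙` on `H^q(Γ, indFun σ)`** for a complete system of orbit
representatives. [cite: Brown1982CohomologyGroups, III §6 (6.2)] -/
theorem sum_indToOrbitCohomology_comp_indOfOrbitCohomology (s : Finset 𝒢)
    (hdisj : ∀ x ∈ s, ∀ y ∈ s, (∃ γ : Γ, ι γ • (x : 𝒢 ⧸ L) = (y : 𝒢 ⧸ L)) → x = y)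
    (hcov : ∀ g : 𝒢, ∃ x ∈ s, ∃ γ : Γ, ι γ • (x : 𝒢 ⧸ L) = (g : 𝒢 ⧸ L)) (q : ℕ) :
    ∑ x ∈ s, (indToOrbitCohomology ι L σ x q ≫ indOfOrbitCohomology ι L σ x q) = 𝟙 _ := by
  simp_rw [indToOrbitCohomology_comp_indOfOrbitCohomology_eq_map]
  rw [← Literature.Algebra.Homology.map_id_sum,
    sum_indOrbitRestrict_comp_indOrbitExtend ι L σ s hdisj hcov, groupCohomology.map_id]

/-- **Orthogonality**: for representatives of different orbits, `of_x ≫ to_y = 0`. [folklore] -/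
theorem indOfOrbitCohomology_comp_indToOrbitCohomology_of_not {g₁ : 𝒢}
    (h : ¬ ∃ γ : Γ, ι γ • (g₀ : 𝒢 ⧸ L) = (g₁ : 𝒢 ⧸ L)) (q : ℕ) :
    indOfOrbitCohomology ι L σ g₀ q ≫ indToOrbitCohomology ι L σ g₁ q = 0 := by
  simp only [indOfOrbitCohomology, indToOrbitCohomology, Category.assoc]
  rw [← groupCohomology.map_id_comp_assoc, indOrbitExtend_comp_indOrbitRestrict_of_not ι L σ g₀ h,
    Literature.Algebra.Homology.map_id_zero, Limits.zero_comp, Limits.comp_zero]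

/-- Evaluation of a finite sum of morphisms of `ModuleCat`. [folklore] -/
private theorem moduleCat_sum_apply' {M M' : ModuleCat.{u} A} {I : Type*} (t : Finset I)
    (φ : I → (M ⟶ M')) (z : M) : (∑ i ∈ t, φ i) z = ∑ i ∈ t, φ i z := by
  change (∑ i ∈ t, φ i).hom z = ∑ i ∈ t, (φ i).hom z
  rw [ModuleCat.hom_sum, LinearMap.sum_apply]

/-- **Shapiro decomposition `H^q(Γ, indFun σ) ≅ ⊕_{x ∈ s} H^q(Γ_{xL}, N_x)`**: for a finite complete
system `s ⊂ 𝒢` of representatives of the `Γ`-orbits on `𝒢 ⧸ L`, `z ↦ (to_x z)_{x ∈ s}` is a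
bijection. [cite: Brown1982CohomologyGroups, III §6 (6.2); Scholze2015, §V.4] -/
theorem indToOrbitCohomology_pi_bijective (s : Finset 𝒢)
    (hdisj : ∀ x ∈ s, ∀ y ∈ s, (∃ γ : Γ, ι γ • (x : 𝒢 ⧸ L) = (y : 𝒢 ⧸ L)) → x = y)
    (hcov : ∀ g : 𝒢, ∃ x ∈ s, ∃ γ : Γ, ι γ • (x : 𝒢 ⧸ L) = (g : 𝒢 ⧸ L)) (q : ℕ) :
    Function.Bijective fun (z : groupCohomology (indFun ι L σ) q) (x : s) =>
      (indToOrbitCohomology ι L σ x.1 q z : groupCohomology (indStabilizerRep ι L σ x.1) q) := by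
  classical
  have hsum : ∀ z : groupCohomology (indFun ι L σ) q,
      ∑ x ∈ s, indOfOrbitCohomology ι L σ x q (indToOrbitCohomology ι L σ x q z) = z := fun z => by
    have h := congrArg (fun φ : groupCohomology (indFun ι L σ) q ⟶ groupCohomology (indFun ι L σ) q =>
      φ z) (sum_indToOrbitCohomology_comp_indOfOrbitCohomology ι L σ s hdisj hcov q)
    simp only at h
    rw [moduleCat_sum_apply'] at h
    exact h
  refine ⟨fun z₁ z₂ h => ?_, fun a => ?_⟩
  · rw [← hsum z₁, ← hsum z₂]
    refine Finset.sum_congr rfl fun x hx => ?_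
    have hx' := congr_fun h ⟨x, hx⟩
    simp only at hx'
    change indOfOrbitCohomology ι L σ x q (indToOrbitCohomology ι L σ x q z₁) =
      indOfOrbitCohomology ι L σ x q (indToOrbitCohomology ι L σ x q z₂)
    rw [hx']
  · refine ⟨∑ x : s, indOfOrbitCohomology ι L σ x.1 q (a x), funext fun y => ?_⟩
    simp only
    rw [map_sum, Finset.sum_eq_single_of_mem y (Finset.mem_univ y) fun x _ hxy => ?_]
    · change (indOfOrbitCohomology ι L σ y.1 q ≫ indToOrbitCohomology ι L σ y.1 q) (a y) = a y
      rw [indOfOrbitCohomology_comp_indToOrbitCohomology]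
      rfl
    · have hne : ¬ ∃ γ : Γ, ι γ • (x.1 : 𝒢 ⧸ L) = (y.1 : 𝒢 ⧸ L) := fun h =>
        hxy (Subtype.ext (hdisj x.1 x.2 y.1 y.2 h))
      change (indOfOrbitCohomology ι L σ x.1 q ≫ indToOrbitCohomology ι L σ y.1 q) (a x) = 0
      rw [indOfOrbitCohomology_comp_indToOrbitCohomology_of_not ι L σ x.1 hne q]
      rfl

/-- **Finitely many orbits with finitely generated stabiliser cohomology give finitely generated
`H^q(Γ, indFun σ)`** — the finiteness of `H^q(X_U, M̃)` over the coefficient ring.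
[cite: Scholze2015, §V.4 (proof of Thm. V.4.1); Brown1982CohomologyGroups, III §6] -/
theorem moduleFinite_cohomology_indFun_of_orbits (s : Finset 𝒢)
    (hdisj : ∀ x ∈ s, ∀ y ∈ s, (∃ γ : Γ, ι γ • (x : 𝒢 ⧸ L) = (y : 𝒢 ⧸ L)) → x = y)
    (hcov : ∀ g : 𝒢, ∃ x ∈ s, ∃ γ : Γ, ι γ • (x : 𝒢 ⧸ L) = (g : 𝒢 ⧸ L)) (q : ℕ)
    (hfin : ∀ x ∈ s, Module.Finite A (groupCohomology (indStabilizerRep ι L σ x) q)) :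
    Module.Finite A (groupCohomology (indFun ι L σ) q) := by
  haveI : ∀ x : s, Module.Finite A (groupCohomology (indStabilizerRep ι L σ x.1) q) :=
    fun x => hfin x.1 x.2
  let f : groupCohomology (indFun ι L σ) q →ₗ[A]
      ∀ x : s, groupCohomology (indStabilizerRep ι L σ x.1) q :=
    LinearMap.pi fun x : s => (indToOrbitCohomology ι L σ x.1 q).hom
  have hf : Function.Bijective f := indToOrbitCohomology_pi_bijective ι L σ s hdisj hcov q
  exact Module.Finite.equiv (LinearEquiv.ofBijective f hf).symm

/-- **Orbit representatives in `𝒢`** from a finite covering family: a finite `s₀ ⊂ 𝒢` whose cosets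
meet every `Γ`-orbit can be thinned to a complete system of DISTINCT orbit representatives.
[folklore] -/
theorem exists_orbit_representatives_ind (s₀ : Finset 𝒢)
    (hcov : ∀ g : 𝒢, ∃ x ∈ s₀, ∃ γ : Γ, ι γ • (x : 𝒢 ⧸ L) = (g : 𝒢 ⧸ L)) :
    ∃ s : Finset 𝒢, s ⊆ s₀ ∧
      (∀ x ∈ s, ∀ y ∈ s, (∃ γ : Γ, ι γ • (x : 𝒢 ⧸ L) = (y : 𝒢 ⧸ L)) → x = y) ∧
      (∀ g : 𝒢, ∃ x ∈ s, ∃ γ : Γ, ι γ • (x : 𝒢 ⧸ L) = (g : 𝒢 ⧸ L)) := by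
  classical
  -- the orbit relation on `𝒢`, an equivalence relation
  let R : 𝒢 → 𝒢 → Prop := fun x y => ∃ γ : Γ, ι γ • (x : 𝒢 ⧸ L) = (y : 𝒢 ⧸ L)
  have hrefl : ∀ x, R x x := fun x => ⟨1, by rw [map_one, one_smul]⟩
  have hsymm : ∀ {x y}, R x y → R y x := fun ⟨γ, hγ⟩ => ⟨γ⁻¹, by rw [← hγ, map_inv ι, inv_smul_smul]⟩
  have htrans : ∀ {x y z}, R x y → R y z → R x z := fun ⟨γ, hγ⟩ ⟨γ', hγ'⟩ =>
    ⟨γ' * γ, by rw [map_mul, mul_smul, hγ, hγ']⟩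
  -- choose one representative in `s₀` per class: the `rep` of the class of `x`
  have hex : ∀ g : 𝒢, ∃ x ∈ s₀, R x g := hcov
  let rep : 𝒢 → 𝒢 := fun g => Classical.choose (hex g)
  have hrep_mem : ∀ g, rep g ∈ s₀ := fun g => (Classical.choose_spec (hex g)).1
  have hrep : ∀ g, R (rep g) g := fun g => (Classical.choose_spec (hex g)).2
  -- representatives chosen CLASS-wise: use `rep` of a canonical element of the class
  let cls : 𝒢 → Set 𝒢 := fun g => {y | R g y}
  have hcls : ∀ {x y}, R x y → cls x = cls y := fun hxy =>
    Set.ext fun z => ⟨fun hz => htrans (hsymm hxy) hz, fun hz => htrans hxy hz⟩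
  let pick : Set 𝒢 → 𝒢 := fun c => if h : ∃ g, cls g = c then rep (Classical.choose h) else 1
  have hpick : ∀ g, R (pick (cls g)) g := fun g => by
    have h : ∃ g', cls g' = cls g := ⟨g, rfl⟩
    simp only [pick, dif_pos h]
    have hg' : cls (Classical.choose h) = cls g := Classical.choose_spec h
    have hR : R (Classical.choose h) g := by
      have : g ∈ cls g := hrefl g
      rw [← hg'] at this
      exact this
    exact htrans (hrep _) hR
  have hpick_mem : ∀ g, pick (cls g) ∈ s₀ := fun g => by
    have h : ∃ g', cls g' = cls g := ⟨g, rfl⟩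
    simp only [pick, dif_pos h]
    exact hrep_mem _
  refine ⟨s₀.filter fun x => pick (cls x) = x, Finset.filter_subset _ _, ?_, ?_⟩
  · intro x hx y hy hxy
    rw [Finset.mem_filter] at hx hy
    rw [← hx.2, ← hy.2, hcls hxy]
  · intro g
    refine ⟨pick (cls g), Finset.mem_filter.2 ⟨hpick_mem g, ?_⟩, hpick g⟩
    rw [hcls (hpick g)]

/-- The same finiteness from a finite covering family, with the hypothesis at all of its points.
[cite: Scholze2015, §V.4 (proof of Thm. V.4.1)] -/
theorem moduleFinite_cohomology_indFun_of_finite_cover (s₀ : Finset 𝒢)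
    (hcov : ∀ g : 𝒢, ∃ x ∈ s₀, ∃ γ : Γ, ι γ • (x : 𝒢 ⧸ L) = (g : 𝒢 ⧸ L)) (q : ℕ)
    (hfin : ∀ x ∈ s₀, Module.Finite A (groupCohomology (indStabilizerRep ι L σ x) q)) :
    Module.Finite A (groupCohomology (indFun ι L σ) q) := by
  obtain ⟨s, hs, hdisj, hcov'⟩ := exists_orbit_representatives_ind ι L s₀ hcov
  exact moduleFinite_cohomology_indFun_of_orbits ι L σ s hdisj hcov' q fun x hx => hfin x (hs hx)

end TwistedQuotient

end Literature.NumberTheory.Automorphic
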